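import Mathlib
import Literature.MathematicalPhysics.QuantumFieldTheory.Balaban1983to89.B3
import Literature.MathematicalPhysics.QuantumFieldTheory.Balaban1983to89.B1RG242Torus

/-!
# `Balaban1983to89.B3Eq26Tower` — T. Bałaban, *(Higgs)₂,₃ quantum fields in a finite volume. III. Renormalization*,
Commun. Math. Phys. **88** (1983) 411–445 [Balaban1983Higgs3]: display (2.6) p. 424, FIRST MEMBER, PROVED at the
level of the tree's renormalization-group towers

statement-level skeleton of published theorems with citation tags; proofs where landed; nothing here is a claim about
the Yang–Mills mass gap

CITATION HEADER / WHAT IS REPRODUCED (unit `lit-balaban-p14` gen 6; SKELETON row `B3.Eq2.6`, fold owner r15,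
`HOME/lit-balaban-r15/ROWS-B3.md`; quotation read from the page render
`run/shared/lean/pub/pub-balaban/b2b-balaban-ref1/pages/1983-cmp88-higgs23-III/1983-cmp88-higgs23-III-p014-x2.png`,
journal page 424 = render p014):
* **(2.6) p. 424**, verbatim: *"Our first step in the proof of the theorem is to write the expression
  E(G, {□(v)}_{v∈G}, Φ_ext, A_ext) = E(G′, {□(v)}_{v∈G}, Φ′_ext, A_ext) as a sum obtained by decomposing all the
  propagators corresponding to the lines of G′ according to the equality*
  `G_k(Ω, B̃) = C^{(0),η}(Ω, B̃) + Σ_{j=1}^{k−1} a_j²(L^jη)^{−4} G_j^η(Ω, B̃) Q_j^*(B̃) C^{(j),L^jη}(Ω, B̃) · Q_j(B̃) G_j^η(Ω, B̃)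
   = Σ_{j=0}^{k−1} G^η_{(j)}(Ω, B̃),  (2.6)`
  *and the similar equality for the vector field propagator."*  The FIRST equality is the renormalization group
  formula (I.2.43)
  [Balaban1982Higgs1, (2.43) p.612] rescaled to the η-lattice (= [Balaban1983RegularityDecay, (2.34) p.582]); the
  SECOND is the definition of the pieces `G^η_{(0)} := C^{(0),η}`, `G^η_{(j)} := a_j²(L^jη)^{−4}G_j^ηQ_j^*C^{(j)}Q_jG_j^η`.
* WHAT THE TREE ALREADY HAS: r15's `B3.Display26 Gk piece k` (the second form, typed over any additive commutative
  monoid of operators) with `B3.display26_of_firstForm` (first form ⇒ second, PROVED); pv07's `B1RG242.Tower` (the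
  RG tower of operators `H = −Δ^{η,N}_{B̃,Ω} + m²`, `Q_j`, `Q_j^*`, `Q`, `Q^*`, `α_j = a_j(L^jη)^{−2}`) with
  `B1RG242.Tower.display243` — (I.2.43) PROVED for every tower satisfying `Tower.Consistent` ((2.13), QQ^* = 1,
  Q_{j+1} = QQ_j and the two invertibilities), in particular from the structural relations + the scalar products
  (1.5) + m² > 0 alone (`display243_of_posDef`) — and the CONCRETE tower `B1RG242Torus.tower P a m²` of Bałaban's
  block averages on the tori `T^{(j)}` with `U = 1`, for which `Consistent` HOLDS (`B1RG242Torus.consistent`,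
  0 < a, 0 ≤ m²) and `G^ε_1 = C^{(0),ε}` (`B1RG242Torus.G_one`).
* PROVED HERE (knitting, no new object): `firstForm_tower` — the first member of (2.6) in B3's order
  (`C^{(0)} + Σ_{j=1}^{k−1} …`) for every consistent tower; `display26_tower` — (2.6), both printed forms, for every
  consistent tower, with `G^η_{(0)} = G_1 = C^{(0),η}` and `G^η_{(j)} = Tower.term j`; `display26_tower_of_posDef` —
  the same from the structural relations + (1.5) + m² > 0; `firstForm_torus` / `display26_torus` — the same for the
  concrete torus tower, NO hypothesis but 0 < a, 0 ≤ m², with the printed coefficient a_j²(L^jε)^{−4}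
  (`B1RG242Torus.term_eq`) and `G_1 = (−Δ^ε + m² + a(Lε)^{−2}Q_1^*Q_1)^{−1} = C^{(0),ε}` (`B1RG242Torus.G_one`).
  SCOPE CAVEAT: B3's `G_k(Ω, B̃)` carries an external gauge field `B̃` and Neumann conditions on `Ω`; these enter the
  abstract tower through its data (`H`, `Q_j(B̃)`, …) and are covered by `display26_tower`; the concrete instance
  `display26_torus` is the case `B̃ = 0`, `Ω` = the whole torus (the case B5 p. 39 "with □ replaced by the whole
  torus").  The *"similar equality for the vector field propagator"* is the same algebra on another tower and is not
  instantiated separately.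
D-0026: no `def`, no named fact; theorems only, standard axioms.
HOME: `run/shared/lean/pub/lit-balaban/` (ROWS-B3.md row B3.Eq2.6; DEPGRAPH §2e.1 #22).
-/

namespace Literature.MathematicalPhysics.QuantumFieldTheory.Balaban1983to89.B3Eq26Tower

open Matrix Finset

/-! ## (2.6) for every consistent renormalization-group tower -/

section Abstract

variable {𝕜 : Type} [Field 𝕜] {ι : Type} [Fintype ι] [DecidableEq ι] (T : B1RG242.Tower 𝕜 ι)

/-- **(2.6) p. 424, first member, in B3's order**: `G_k = C^{(0),η} + Σ_{j=1}^{k−1} a_j²(L^jη)^{−4}G_j^ηQ_j^*C^{(j),L^jη}Q_jG_j^η`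
(`k ≥ 1`), for every consistent RG tower — (I.2.43) `B1RG242.Tower.display243` with the two summands exchanged;
`C^{(0),η} = G_1` ((I.2.17)/(I.2.30) at the first level). [cite: Balaban1983Higgs3, (2.6) p.424; Balaban1982Higgs1, (2.43) p.612] -/
theorem firstForm_tower (h : T.Consistent) (k : ℕ) (hk : 1 ≤ k) :
    T.G k = T.G 1 + ∑ j ∈ Finset.Ico 1 k, T.term j := by
  rw [T.display243 h k hk, add_comm]

/-- **(2.6) p. 424, both members**: `G_k = C^{(0),η} + Σ_{j=1}^{k−1} (…) = Σ_{j=0}^{k−1} G^η_{(j)}` with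
`G^η_{(0)} := C^{(0),η} = G_1` and `G^η_{(j)} := a_j²(L^jη)^{−4}G_j^ηQ_j^*C^{(j),L^jη}Q_jG_j^η = Tower.term j` (`1 ≤ j`),
for every consistent RG tower (r15's `B3.Display26` instantiated; kernel `B3.display26_of_firstForm`).
[cite: Balaban1983Higgs3, (2.6) p.424] -/
theorem display26_tower (h : T.Consistent) (k : ℕ) (hk : 1 ≤ k) :
    B3.Display26 (T.G k) (fun j => if j = 0 then T.G 1 else T.term j) k :=
  B3.display26_of_firstForm (T.G k) (T.G 1) T.term k hk (firstForm_tower T h k hk)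

end Abstract

/-- **(2.6) p. 424 over ℝ from the structural tower relations, the scalar products (I.1.5) at every level and
`m² > 0` alone** (the invertibilities of `Consistent` then follow, `B1RG242.Tower.consistent_of_posDef` — the
finite-lattice content of "It is so", [Balaban1982Higgs1] p. 611). [cite: Balaban1983Higgs3, (2.6) p.424;
Balaban1982Higgs1, (2.30)–(2.31) p.611] -/
theorem display26_tower_of_posDef {ι : Type} [Fintype ι] [DecidableEq ι] (T : B1RG242.Tower ℝ ι)
    (WE : Matrix ι ι ℝ) (W : ∀ j, Matrix (T.κ j) (T.κ j) ℝ)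
    (hQ : ∀ j, 1 ≤ j → T.Q j * T.Qs j = 1) (hQk : ∀ j, 1 ≤ j → T.Qk (j + 1) = T.Q j * T.Qk j)
    (hQks : ∀ j, 1 ≤ j → T.Qks (j + 1) = T.Qks j * T.Qs j)
    (hα : ∀ j, 1 ≤ j → T.α (j + 1) = T.α j * T.β j / (T.α j + T.β j))
    (E : ∀ j, 1 ≤ j → (T.step j).ScalarProducts WE (W j) (W (j + 1)))
    (hH : ∀ φ, φ ≠ 0 → 0 < φ ⬝ᵥ (WE *ᵥ (T.H *ᵥ φ))) (k : ℕ) (hk : 1 ≤ k) :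
    B3.Display26 (T.G k) (fun j => if j = 0 then T.G 1 else T.term j) k :=
  display26_tower T (T.consistent_of_posDef WE W hQ hQk hQks hα E hH) k hk

/-! ## (2.6) for Bałaban's concrete tower on the tori (U = 1, the whole torus) -/

section Torus

variable (P : Params)

/-- **(2.6) p. 424, first member, for the CONCRETE tower** `B1RG242Torus.tower P a m²` (block averages
`Q_j = L^{−jd}Σ_{B^j(y)}`, `H = −Δ^ε + m²`, `a_j = B1.aSeq a L j`; U = 1, whole torus), NO hypothesis but `0 < a`,
`0 ≤ m²`: `G_k = G_1 + Σ_{j=1}^{k−1} term j`, where `G_1 = (−Δ^ε + m² + a(Lε)^{−2}Q_1^*Q_1)^{−1} = C^{(0),ε}`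
(`B1RG242Torus.G_one`) and `term j = a_j²(L^jε)^{−4} • (G_jQ_j^*C^{(j)}Q_jG_j)` (`B1RG242Torus.term_eq`).
[cite: Balaban1983Higgs3, (2.6) p.424; Balaban1983RegularityDecay, (2.34) p.582] -/
theorem firstForm_torus {a msq : ℝ} (ha : 0 < a) (hm : 0 ≤ msq) (k : ℕ) (hk : 1 ≤ k) :
    (B1RG242Torus.tower P a msq).G k
      = (B1RG242Torus.tower P a msq).G 1 + ∑ j ∈ Finset.Ico 1 k, (B1RG242Torus.tower P a msq).term j :=
  firstForm_tower _ (B1RG242Torus.consistent P ha hm) k hk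

/-- **(2.6) p. 424, both members, for the CONCRETE tower** `B1RG242Torus.tower P a m²`, NO hypothesis but `0 < a`,
`0 ≤ m²`: `G_k = Σ_{j=0}^{k−1} G^ε_{(j)}` with `G^ε_{(0)} = G_1 = C^{(0),ε}` and `G^ε_{(j)} = term j` (`1 ≤ j ≤ k − 1`).
[cite: Balaban1983Higgs3, (2.6) p.424] -/
theorem display26_torus {a msq : ℝ} (ha : 0 < a) (hm : 0 ≤ msq) (k : ℕ) (hk : 1 ≤ k) :
    B3.Display26 ((B1RG242Torus.tower P a msq).G k)
      (fun j => if j = 0 then (B1RG242Torus.tower P a msq).G 1 else (B1RG242Torus.tower P a msq).term j) k :=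
  display26_tower _ (B1RG242Torus.consistent P ha hm) k hk

/-- The same with the level-0 piece written as the printed covariance `C^{(0),ε} = (−Δ^ε + m² + a(Lε)^{−2}Q_1^*Q_1)^{−1}`
((I.2.17)/(I.2.30); `B1RG242Torus.G_one`) and the pieces `j ≥ 1` with the printed coefficient `a_j²(L^jε)^{−4}`
(`B1RG242Torus.term_eq`). [cite: Balaban1983Higgs3, (2.6) p.424; Balaban1982Higgs1, (2.30) p.611, (2.43) p.612] -/
theorem display26_torus_printed {a msq : ℝ} (ha : 0 < a) (hm : 0 ≤ msq) (k : ℕ) (hk : 1 ≤ k) :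
    B3.Display26 ((B1RG242Torus.tower P a msq).G k)
      (fun j => if j = 0 then
          (B1RG242Torus.H P msq + (a * (P.spacing 1 ^ 2)⁻¹) • (B1RG242Torus.Qks P 1 * B1RG242Torus.Qk P 1))⁻¹
        else (B1.aSeq a P.L j ^ 2 * (P.spacing j ^ 4)⁻¹)
          • ((B1RG242Torus.tower P a msq).G j * (B1RG242Torus.tower P a msq).Qks j
              * (B1RG242Torus.tower P a msq).C j * (B1RG242Torus.tower P a msq).Qk j
              * (B1RG242Torus.tower P a msq).G j)) k := by
  have hfun : (fun j => if j = 0 then (B1RG242Torus.tower P a msq).G 1 else (B1RG242Torus.tower P a msq).term j)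
      = (fun j => if j = 0 then
          (B1RG242Torus.H P msq + (a * (P.spacing 1 ^ 2)⁻¹) • (B1RG242Torus.Qks P 1 * B1RG242Torus.Qk P 1))⁻¹
        else (B1.aSeq a P.L j ^ 2 * (P.spacing j ^ 4)⁻¹)
          • ((B1RG242Torus.tower P a msq).G j * (B1RG242Torus.tower P a msq).Qks j
              * (B1RG242Torus.tower P a msq).C j * (B1RG242Torus.tower P a msq).Qk j
              * (B1RG242Torus.tower P a msq).G j)) := by
    funext j
    split_ifs
    · exact B1RG242Torus.G_one a msq
    · exact B1RG242Torus.term_eq a msq j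
  rw [← hfun]
  exact display26_torus P ha hm k hk

end Torus

end Literature.MathematicalPhysics.QuantumFieldTheory.Balaban1983to89.B3Eq26Tower
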